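import Mathlib
import Summits.Ventures.PercRepro2.HalfLA12Blocks
import Summits.Ventures.PercRepro2.HalfLA1O

/-!
# HALF-L and (HCOV) for `a₃ ~ {a₁, a₂}` — `a₃` adjacent only to the two roots (blind cell PercRepro2, night-1 g37)

`GammaLc_a12`: `ΓLc = 2 · HalfLA12.lhs (p e₁) (p e₂) (cellsA12 …)` for `CaseOne.IsTwoMarkAt ends a₁ a₂ a₃ e₁ e₂`;
**`HalfL_a12`**: HALF-L on the class, every weight, every base graph.
-/

namespace Summit.Ventures.PercRepro2

namespace HalfLA12

open CaseOne CovForm SharpHalves UnionCluster HalfLTwoMark HalfLA2B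

section Main

variable {V : Type*} {E : Type*} [Fintype E] [DecidableEq E] [Fintype V] [DecidableEq V]
  {R : Type*} [Field R] [LinearOrder R] [IsStrictOrderedRing R]
variable {ends : E → Sym2 V} {o a₃ b : V} {e₁ e₂ : E}

omit [Fintype V] in
/-- **`ΓLc` for `a₃ ~ {a₁, a₂}`**: `ΓLc = 2 · lhs r₁ r₂ (cells)`. -/
theorem GammaLc_a12 (p : E → R) {a₁ a₂ : V} (h : IsTwoMarkAt ends a₁ a₂ a₃ e₁ e₂) (ho3 : o ≠ a₃)
    (hb3 : b ≠ a₃) :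
    GammaLc p ends o a₁ a₂ a₃ b = 2 * lhs (p e₁) (p e₂) (cellsA12 p ends o a₁ a₂ b e₁ e₂) := by
  rw [HalfEndpoint.GammaLc_eq_endpoint p ends o a₁ a₂ a₃ b, HalfLTwoMark.Do_eq,
    HalfLTwoMark.avoidAll_eq_Q, HalfLTwoMark.TEvent_eq, HalfLTwoMark.Dtilde_eq]
  have ePD : PDEvent ends a₁ a₂ a₃ =
      (connEvent ends a₁ a₂)ᶜ ∩ (connEvent ends a₃ a₁ ∪ connEvent ends a₃ a₂)ᶜ := rfl
  rw [ePD]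
  have cT := prob_inter_add_prob_inter_compl p ((connEvent ends a₁ a₂)ᶜ ∩ connEvent ends a₂ a₃)
    (connEvent ends a₁ o ∪ connEvent ends a₂ o)
  have cTb := prob_inter_add_prob_inter_compl p
    ((connEvent ends a₁ a₂)ᶜ ∩ connEvent ends a₂ a₃ ∩ connEvent ends a₁ b)
    (connEvent ends a₁ o ∪ connEvent ends a₂ o)
  have eTb : (connEvent ends a₁ a₂)ᶜ ∩ connEvent ends a₂ a₃ ∩
      (connEvent ends a₁ b ∩ (connEvent ends a₁ o ∪ connEvent ends a₂ o)ᶜ) =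
      (connEvent ends a₁ a₂)ᶜ ∩ connEvent ends a₂ a₃ ∩ connEvent ends a₁ b ∩
        (connEvent ends a₁ o ∪ connEvent ends a₂ o)ᶜ := (Set.inter_assoc _ _ _).symm
  have ebLoH : (connEvent ends a₁ a₂)ᶜ ∩ (connEvent ends a₂ o ∩ connEvent ends a₁ b) =
      (connEvent ends a₁ a₂)ᶜ ∩ connEvent ends a₂ o ∩ connEvent ends a₁ b := (Set.inter_assoc _ _ _).symm
  rw [eTb, ebLoH]
  rw [mass_Q p h ho3 hb3, mass_bL p h ho3 hb3, mass_T p h ho3 hb3, mass_TbL p h ho3 hb3,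
    mass_TbLoU p h ho3 hb3, mass_oH p h ho3 hb3, mass_bLoH p h ho3 hb3, mass_ToU p h ho3 hb3,
    mass_PD p h ho3 hb3, mass_PDoU p h ho3 hb3] at *
  unfold lhs
  linear_combination (2 * mPD (p e₁) (p e₂) (cellsA12 p ends o a₁ a₂ b e₁ e₂) *
      mbL (p e₁) (p e₂) (cellsA12 p ends o a₁ a₂ b e₁ e₂)) * cT -
    (2 * mPD (p e₁) (p e₂) (cellsA12 p ends o a₁ a₂ b e₁ e₂) *
      mQ (p e₁) (p e₂) (cellsA12 p ends o a₁ a₂ b e₁ e₂)) * cTb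

/-- **HALF-L on the class `a₃ ~ {a₁, a₂}`**, every weight. -/
theorem HalfL_a12 (p : E → R) (hp : IsProbVec p) {a₁ a₂ : V} (h : IsTwoMarkAt ends a₁ a₂ a₃ e₁ e₂)
    (ho3 : o ≠ a₃) (hb3 : b ≠ a₃) : HalfL p ends o a₁ a₂ a₃ b := by
  unfold HalfL
  rw [GammaLc_a12 p h ho3 hb3]
  have := lhs_nonneg (p e₁) (p e₂) (cellsA12 p ends o a₁ a₂ b e₁ e₂)
    (cellsNonneg p hp ends o a₁ a₂ b e₁ e₂) (blocksNonneg p hp ends o a₁ a₂ b e₁ e₂)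
    (hp.nonneg e₁) (hp.le_one e₁) (hp.nonneg e₂) (hp.le_one e₂)
  linarith

omit [Fintype E] [DecidableEq E] [Fintype V] [DecidableEq V] in
/-- The root-swapped instance of the class. -/
lemma isTwoMarkAt_swap {a₁ a₂ : V} (h : IsTwoMarkAt ends a₁ a₂ a₃ e₁ e₂) :
    IsTwoMarkAt ends a₂ a₁ a₃ e₂ e₁ :=
  ⟨h.ends_b, h.ends_o, h.ne.symm, fun e he => (h.unique e he).symm, h.ne_b, h.ne_o⟩

/-- **(HCOV) for `a₃ ~ {a₁, a₂}`** (a₃ adjacent only to the two roots): both halves by `HalfL_a12`. -/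
theorem HCov_a12 (p : E → R) (hp : IsProbVec p) {a₁ a₂ : V} (h : IsTwoMarkAt ends a₁ a₂ a₃ e₁ e₂)
    (ho3 : o ≠ a₃) (hb3 : b ≠ a₃) : HCov p ends o a₁ a₂ a₃ b :=
  HCov_of_HalfL_HalfH p ends o a₁ a₂ a₃ b (HalfL_a12 p hp h ho3 hb3)
    ((HalfH_iff p ends o a₁ a₂ a₃ b).2 (HalfL_a12 p hp (isTwoMarkAt_swap h) ho3 hb3))

end Main

end HalfLA12

end Summit.Ventures.PercRepro2
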